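import Summits.QuantumFields.GaugeBoot.WilsonLoopsGenerateInvariants
import Summits.QuantumFields.GaugeBoot.AbelianBootstrapFunctionals
import HarnessLib

/-!
# The algebra of gauge-invariant polynomial observables IS the Wilson loop algebra; the abelian case (gauge-boot, FFT corollary 2)

HONEST FRAMING (cell `pub-gaugeboot`, page 1 of every file): the venture produces certified bounds
on lattice expectations at stated coupling, gauge group, dimension and torus size; NOT a mass gap,
NOT a continuum limit, NOT a string tension; NOT Yang–Mills-summit-bearing (barriers
`FixedCouplingUltralocality`, `PerturbativeInvisibility`). Structural; no number is certified.

## Content (torus `(ℤ/L)^d`, `L ≥ 1`)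

* `gaugeInvariantPolyAlgebra r` — the gauge-invariant polynomial observables as a unital
  `ℝ`-subalgebra of `C(U, ℝ)` (the object whose values are the unknowns of a lattice bootstrap on
  gauge-invariant data).
* ★★★ `gaugeInvariantPolyAlgebra_eq_loopAlgebra` — for a compact gauge group with
  `SU(N) ⊆ ρ(G) ⊆ U(N)`, `N ≥ 1`: IT EQUALS THE WILSON LOOP ALGEBRA at the base point (the first
  fundamental theorem `isGaugeInvariant_iff_mem_loopAlgebra` as an equality of algebras);
  instances `_suN`, `_uN`.
* ★★ `gaugeInvariantPolyAlgebra_eq_loopAlgebra_u1` / `isGaugeInvariant_iff_mem_loopAlgebra_u1` —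
  THE ABELIAN CASE `U(1)` (`N = 1`, `SU(1) = 1` so the hypothesis is empty): the gauge-invariant
  polynomials in the link phases `U_e, Ū_e` are exactly the polynomials in the Wilson loops
  `∏_{e ∈ w} U_e^{±1}` of closed words — the statement "U(1) characters of closed loops span the
  gauge-invariant polynomials" (gen 73's open item (xvii)); with the lane's
  `eq_wilson_of_abelianBootstrap_u1` the abelian bootstrap's test functions and unknowns are
  literally Wilson-loop polynomials (`eq_wilson_on_loopAlgebra_of_abelianBootstrap_u1`).

References: B. Durhuus, Lett. Math. Phys. 4 (1980) 515–522; Z. Li, S. Zhou, arXiv:2404.17071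
(abelian lattice bootstrap). Folklore given the FFT.
-/

noncomputable section

namespace Summit.QuantumFields.GaugeBoot

open MeasureTheory
open Literature.MathematicalPhysics.QuantumFieldTheory (Site Edge GaugeConfig LatticeRep gaugeTransform
  IsGaugeInvariant wilsonMeasure wilsonAction)
open Literature.MathematicalPhysics.QuantumLattice

variable {d L : ℕ} {G : Type*} [Group G] [TopologicalSpace G] [IsTopologicalGroup G] (r : LatticeRep G)

/-- **The gauge-invariant polynomial observables** as a unital `ℝ`-subalgebra of `C(U, ℝ)`.
[folklore] -/
def gaugeInvariantPolyAlgebra : Subalgebra ℝ C(GaugeConfig d L G, ℝ) where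
  carrier := {f | f ∈ polyAlgebra (ι := Edge d L) r ∧ IsGaugeInvariant (⇑f)}
  mul_mem' {f g} hf hg := ⟨Subalgebra.mul_mem _ hf.1 hg.1, fun γ U => by
    simp only [ContinuousMap.mul_apply, hf.2 γ U, hg.2 γ U]⟩
  one_mem' := ⟨Subalgebra.one_mem _, fun γ U => rfl⟩
  add_mem' {f g} hf hg := ⟨Subalgebra.add_mem _ hf.1 hg.1, fun γ U => by
    simp only [ContinuousMap.add_apply, hf.2 γ U, hg.2 γ U]⟩
  zero_mem' := ⟨Subalgebra.zero_mem _, fun γ U => rfl⟩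
  algebraMap_mem' c := ⟨Subalgebra.algebraMap_mem _ c, fun γ U => rfl⟩

omit [IsTopologicalGroup G] in
/-- Membership in `gaugeInvariantPolyAlgebra`. -/
@[simp] theorem mem_gaugeInvariantPolyAlgebra {f : C(GaugeConfig d L G, ℝ)} :
    f ∈ gaugeInvariantPolyAlgebra (d := d) (L := L) r ↔
      f ∈ polyAlgebra (ι := Edge d L) r ∧ IsGaugeInvariant (⇑f) := Iff.rfl

/-- The Wilson loop algebra is contained in the gauge-invariant polynomial algebra (any group). -/
theorem loopAlgebra_le_gaugeInvariantPolyAlgebra (x : Site d L) :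
    loopAlgebra (d := d) (L := L) r x ≤ gaugeInvariantPolyAlgebra (d := d) (L := L) r :=
  fun _ hf => loopAlgebra_le r x hf

variable [CompactSpace G] [MeasurableSpace G] [BorelSpace G] [SecondCountableTopology G] [NeZero L]
variable {r}

/-- ★★★ **FIRST FUNDAMENTAL THEOREM, algebra form**: for a compact gauge group with
`SU(N) ⊆ ρ(G) ⊆ U(N)`, `N ≥ 1`, the algebra of gauge-invariant polynomial observables on the torus
IS the Wilson loop algebra at the base point. -/
theorem gaugeInvariantPolyAlgebra_eq_loopAlgebra (hSU : TensorFFT.ContainsSU r) (hN : 0 < r.N) :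
    gaugeInvariantPolyAlgebra (d := d) (L := L) r = loopAlgebra (d := d) (L := L) r 0 :=
  le_antisymm (fun _ hf => mem_loopAlgebra_of_isGaugeInvariant hSU hN hf.1 hf.2)
    (loopAlgebra_le_gaugeInvariantPolyAlgebra r 0)

/-- ★★★ `SU(N)`: gauge-invariant polynomial observables = Wilson loop algebra. -/
theorem gaugeInvariantPolyAlgebra_eq_loopAlgebra_suN (N : ℕ) (hN : 0 < N) :
    gaugeInvariantPolyAlgebra (d := d) (L := L) (fundamentalLatticeRep N) =
      loopAlgebra (d := d) (L := L) (fundamentalLatticeRep N) 0 :=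
  gaugeInvariantPolyAlgebra_eq_loopAlgebra (containsSU_suN N) hN

/-- ★★★ `U(N)`: gauge-invariant polynomial observables = Wilson loop algebra. -/
theorem gaugeInvariantPolyAlgebra_eq_loopAlgebra_uN (N : ℕ) (hN : 0 < N) :
    gaugeInvariantPolyAlgebra (d := d) (L := L) (unitaryFundamentalLatticeRep N) =
      loopAlgebra (d := d) (L := L) (unitaryFundamentalLatticeRep N) 0 :=
  gaugeInvariantPolyAlgebra_eq_loopAlgebra (containsSU_uN N) hN

/-! ## The abelian case `U(1)` -/

/-- ★★ **`U(1)` LATTICE GAUGE THEORY: the gauge-invariant polynomials in the link phases are exactly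
the polynomials in the Wilson loops** `∏_{e ∈ w} U_e^{±1}`, `w` closed (the `N = 1` case of the
first fundamental theorem: `SU(1)` is trivial, so no hypothesis remains). -/
theorem gaugeInvariantPolyAlgebra_eq_loopAlgebra_u1 :
    gaugeInvariantPolyAlgebra (d := d) (L := L) (unitaryFundamentalLatticeRep 1) =
      loopAlgebra (d := d) (L := L) (unitaryFundamentalLatticeRep 1) 0 :=
  gaugeInvariantPolyAlgebra_eq_loopAlgebra_uN 1 Nat.one_pos

/-- ★★ `U(1)`: a polynomial observable is gauge invariant iff it is a Wilson-loop polynomial. -/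
theorem isGaugeInvariant_iff_mem_loopAlgebra_u1 {f : C(GaugeConfig d L (Matrix.unitaryGroup (Fin 1) ℂ), ℝ)}
    (hf : f ∈ polyAlgebra (ι := Edge d L) (unitaryFundamentalLatticeRep 1)) :
    IsGaugeInvariant (⇑f) ↔ f ∈ loopAlgebra (d := d) (L := L) (unitaryFundamentalLatticeRep 1) 0 :=
  isGaugeInvariant_iff_mem_loopAlgebra_uN 1 Nat.one_pos hf

/-- ★★ **The abelian bootstrap read on Wilson loops** (`U(1)` torus, ANY real `β`): normalisation,
square-positivity on the polynomials and the loop equations for gauge-invariant polynomial test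
functions give EVERY Wilson-loop polynomial its Wilson expectation (the lane's
`eq_wilson_of_abelianBootstrap_u1` + the `U(1)` first fundamental theorem). -/
theorem eq_wilson_on_loopAlgebra_of_abelianBootstrap_u1 (β : ℝ)
    {φ : C(GaugeConfig d L (Matrix.unitaryGroup (Fin 1) ℂ), ℝ) →ₗ[ℝ] ℝ} (h1 : φ 1 = 1)
    (hpos : ∀ a ∈ polyAlgebra (ι := Edge d L) (unitaryFundamentalLatticeRep 1), 0 ≤ φ (a * a))
    (hφ : IsSDFunctionalOn (unitaryFundamentalLatticeRep 1) IsGaugeInvariant (uExp 1)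
      (fun _ => wilsonAction (unitaryFundamentalRep (Fin 1) ℂ)) β φ)
    {f : C(GaugeConfig d L (Matrix.unitaryGroup (Fin 1) ℂ), ℝ)}
    (hf : f ∈ loopAlgebra (d := d) (L := L) (unitaryFundamentalLatticeRep 1) 0) :
    φ f = ∫ U, f U ∂(wilsonMeasure (unitaryFundamentalRep (Fin 1) ℂ) β) :=
  eq_wilson_of_abelianBootstrap_u1 β h1 hpos hφ (loopAlgebra_le _ 0 hf).1 (loopAlgebra_le _ 0 hf).2

/-- ★ The test functions of the abelian bootstrap (gauge-invariant polynomials) are exactly the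
Wilson-loop polynomials: the two classes coincide on the polynomial observables. -/
theorem isGaugeInvariant_poly_iff_loop_u1 (f : C(GaugeConfig d L (Matrix.unitaryGroup (Fin 1) ℂ), ℝ)) :
    (f ∈ polyAlgebra (ι := Edge d L) (unitaryFundamentalLatticeRep 1) ∧ IsGaugeInvariant (⇑f)) ↔
      f ∈ loopAlgebra (d := d) (L := L) (unitaryFundamentalLatticeRep 1) 0 := by
  rw [← mem_gaugeInvariantPolyAlgebra, gaugeInvariantPolyAlgebra_eq_loopAlgebra_u1]

end Summit.QuantumFields.GaugeBoot

end
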